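import Summits.ABC.ABC.Theorems.DefiniteXiPeterssonLowerBound
import Summits.ABC.ABC.Theses.IsogenyGlueCongruence
import HarnessLib

/-!
# `IsogenyGlueCongruence.PeterssonLowerBound` (stmt-ABC-10870, shared with route `DefiniteXi`) from the `Sym⁴` package

The support decl `Summit.ABC.ABC.Theses.IsogenyGlueCongruence.PeterssonLowerBound` is the SAME term as the crux
`Summit.ABC.ABC.Theses.DefiniteXi.PeterssonLowerBound` (both are verbatim the named fact
`murty_petersson_newform_lower_bound`). The landed composition
`Summit.ABC.ABC.Theorems.PeterssonLowerBound_of` (`Theorems/DefiniteXiPeterssonLowerBound.lean`, p107692: line `Sketch`,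
Goldfeld–Hoffstein–Lieman on the Siegel ball with the single automorphic input `L^{(N)}(s, Sym⁴ E)`) therefore gives
the `IsogenyGlueCongruence` decl BY NAME, conditionally on the one Literature named fact
`Literature.NumberTheory.Automorphic.Kim2003_symmFourL_nonCM_entire_polyBound` (Kim 2003 Thm B; Kim–Shahidi 2002;
Godement–Jacquet; convexity). This file records that conditional bridge for the second route; the item closes by
`IsogenyGlueCongruence_PeterssonLowerBound_of Kim2003_symmFourL_nonCM_entire_polyBound_holds` the day the fact is
discharged.
-/

noncomputable section

set_option linter.dupNamespace false

namespace Summit.ABC.ABC.Theorems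

/-- **Route `IsogenyGlueCongruence`'s `PeterssonLowerBound`, conditionally on the `Sym⁴` package**: for every
`ε > 0` there is `c > 0` with `c·N^{1−ε} ≤ Re ⟨f,f⟩_{Γ₀(N)}` for the newform `f` of every elliptic curve over `ℚ`,
GIVEN the analytic package of `L(s, Sym⁴ E)` for non-CM `E/ℚ` (the hypothesis `hSym4`, a Literature named fact).
Same term as the `DefiniteXi` crux; proof = the landed composition `PeterssonLowerBound_of`.
[cite: HoffsteinLockhart1994, Thm. 0.1] [cite: MurtyCongruencePrimes1999, §2] -/
theorem IsogenyGlueCongruence_PeterssonLowerBound_of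
    (hSym4 : Literature.NumberTheory.Automorphic.Kim2003_symmFourL_nonCM_entire_polyBound) :
    Summit.ABC.ABC.Theses.IsogenyGlueCongruence.PeterssonLowerBound :=
  Summit.ABC.ABC.Theorems.PeterssonLowerBound_of hSym4

end Summit.ABC.ABC.Theorems

end
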